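import Literature.MathematicalPhysics.QuantumFieldTheory.Balaban1983to89.B9Thm312WholeHolder
import Literature.MathematicalPhysics.QuantumFieldTheory.Balaban1983to89.B9Thm312WholeL2
import Literature.MathematicalPhysics.QuantumFieldTheory.Balaban1983to89.B9RWSumsReadsRel
import Literature.MathematicalPhysics.QuantumFieldTheory.Balaban1983to89.B9SectBStepWhole

/-!
# `Balaban1983to89.B9Thm312WholeBlocksRel` — [B9] Theorem 3.12 (p. 423): the L² BLOCK (3.46) and the HÖLDER BLOCK (3.43)–(3.45) of a
# kernel family CO-READ (relative to a block equivalence) by a Sect.-D propagator A ∈ {G, G₁}, at one member and one configuration,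
# from the operator-level schemas — the typed blocks `B9FromB6.L2Block K … U` and `B9.Ineq343_345 K … U` that the row-20∕21 leaves displayed

T. Bałaban, *Propagators for lattice gauge theories in a background field*, Commun. Math. Phys. **99** (1985) 389–434
[`Balaban1985BackgroundPropagators`, "B9"]; [4] = T. Bałaban, *Propagators and renormalization transformations for lattice
gauge theories. II*, Commun. Math. Phys. **96** (1984) 223–250 [`Balaban1984PropagatorsII`].

statement-level skeleton of published theorems with citation tags; proofs where landed; nothing here is a claim about the
Yang–Mills mass gap

THE PRINTED LOCI are those of `…B9Thm312WholeClasses` and `…B9Thm312WholeL2` (verbatim there): (3.43)–(3.46) p. 398, Theorem 3.3 p. 399,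
(3.130)–(3.131) pp. 421–422, (3.138) and the Hölder pattern p. 423, Theorem 3.12 p. 423, [4] (2.51)–(2.52) p. 232 and Lemma 2.1 p. 234.

THE POINT.  Seat n06-l's leaves of rows 20–21 display, per member and per configuration, the residual `hres`: `L2Block K B₁ δ₁ U ∧
B9.Ineq343_345 K Bβ Bε Bεβ δ₁ U` for K ∈ [G_D, G₁] (and for 𝔊).  THIS FILE derives EXACTLY these two typed blocks for a kernel family K
whose (3.43)–(3.46) quantities are CO-READ, RELATIVE TO A BLOCK EQUIVALENCE `Rel` (n06-k's `L2ReadsRel` ∕ `H1ReadsRel` ∕ `InputReadsRel`, the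
dischargeable species after the shared-block refutation `B9CoRealizesSharedBlock`), by the model operators built from A ∈ {G, G₁}:
* §1 reading level (generic): `l2Block_of_blockBds_rel` — six block-L² bounds of printed shape + six `L2ReadsRel` + multiplicity ∕ saturation
  ⇒ `L2Block K (m²·K_L) δ U` (n06-k `l2line_of_blockBd_rel` ×6); `ineq343_345_of_majorants_rel` — the two probe majorants + the two input-class
  majorants + `H1ReadsRel` + `InputReadsRel` ⇒ `B9.Ineq343_345 K (m·B_h) K₄₄ K₄₅ δ U` (n06-k `line343_of_hasMajorantHom_rel` +
  `lines3445_of_hasMaj_rel`); `thm33G0L2_mono` (rates of the L² schema).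
* §2 ONE MEMBER, ONE U, ONE PROPAGATOR A (with (Δ_a − T)A = I, T = Δ′_π or Δ′_π + Δ⁽²⁾_π): ★ `l2Block_of_step` and ★ `holder_of_step` — from Theorem 3.3 for G₀ in every
  class (`Thm33G0.e0∕e2`, `LeftStep.e1`, `Thm33G0H`, `Thm33G0L2`), the perturbation step in every class (`Step`, `LeftStep.stepD`, `StepH`,
  `StepL2`), the transposition letters (A symmetric, (∇_UA)ᵀ = A∇\*_U), [4] Lemma 2.1 ((2.61) as `RowSum` at σ, (2.60) as three
  `ScaleTransfer`s), the relative co-readings and the class data (multiplicity m, saturation), under the located smallness θc < 1,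
  B₂θ₂c² < 1 and the rate bookkeeping ρ ≦ δ₀, ρ + σ ≦ δ_K, ρ_f + σ ≦ (1 − α)ρ, ρ_f + 2σ + αρ ≦ ρ: BOTH BLOCKS at the rate ρ_f with
  explicit constants (`constL2 …`, m·(B_h(β) + θ_H B₀(1 − θc)⁻¹c), …) — the operator-level work is `…Holder.probe43L∕43R∕input44∕45_of_step`
  and `…L2.l2bd_entry0∕12_of_sup`, `l2bd_entry3∕4∕5_of_step`.
The family leaves (`…B9Thm312WholeLeafAll`, `…B9Thm313WholeLeafAll`) call `l2Block_of_step` ∕ `holder_of_step` twice per member (A = G with Δ′_π, A = G₁ with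
Δ′_π + Δ⁽²⁾_π) where they used to read `hres`.

HONEST SCOPE.  Nothing of [B9] or [4] is asserted: every schema, letter, reading and member fact is a HYPOTHESIS of printed ∕ definitional
shape; the content is print's one-sentence argument (p. 422) carried out class by class, kernel-checked.  NOT a node discharge, NOT summit
progress; one finite lattice at a time; nothing continuum, nothing about the mass gap.  Cell `pub-ymgap` (HUMAN RULING D-0062), Track A
node N06 [B9], N06-ASSIGNMENT v1 rows 20–21 (bundle F7), seat `pub-ymgap-dag-n06-l` (g4), 2026-08-27.
-/

namespace Literature.MathematicalPhysics.QuantumFieldTheory.Balaban1983to89.B9Thm312WholeBlocksRel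

open Literature.MathematicalPhysics.QuantumFieldTheory.Balaban1983to89
open Finset B6RandomWalk B6RandomWalkHom B9Thm34Ext B9Thm37Glue B9Thm37GlueCor36 B11SectG B9SectDSup B9SectDL2Decay
open B9Thm37AllNorms B9Thm37AllNormsInstances B9FromB6 B9FromB6ModelSignsOn B9SectBStepWhole B9Thm312Whole B9Thm312WholeLeaf
open B9Thm312WholeLeft B9RWSums343Holder B9RWSums346Schur B9RWSumsReadsRel B9Ineq347 B9Thm312WholeClasses B9Thm312WholeHolder
open B9Thm312WholeL2

noncomputable section

/-! ## §1 Reading level: the two typed blocks from operator-level majorants and relative co-readings -/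

section Reading

variable {g : B9.Geometry} [Fintype g.Site] [DecidableEq g.Site] {R : ℝ} {H : Prop} {B : B9.Backgrounds}
variable {X Y PX PY : Type} [Fintype X] [Fintype Y] [Fintype PX] [Fintype PY]

omit [Fintype PX] [Fintype PY] in
/-- **THE L² BLOCK (3.46) OF A CO-READ KERNEL FAMILY from six block-L² bounds of printed shape**, relative reading: if the model operators
A₀, …, A₅ (types of A, ∇_UA, A∇\*_U, Δ_UA, ∇_UA∇\*_U, AΔ_U) have r1's block bounds K_L·pref6(Lʲη)ₙ·e^{−δd(y,y′)}, `K.l2 n` is co-read by Aₙ relative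
to `Rel` (n06-k `L2ReadsRel`), the classes have at most m members and Lʲη, d are saturated on classes, then `L2Block K (m·m·K_L) δ U`
(n06-k's `l2line_of_blockBd_rel`, line by line). [cite: Balaban1985BackgroundPropagators, (3.46) p.398; Balaban1984PropagatorsII, (2.51)–(2.52) p.232] -/
theorem l2Block_of_blockBds_rel {K : B9.KernelFamily g B} {U : B.Cfg} {Rel : g.Site → g.Site → Prop} [DecidableRel Rel]
    {blk : X → g.Site} {blkY : Y → g.Site} {ev : g.Loc → X → ℝ} {evY : g.Loc → Y → ℝ}
    {A0 A3 A5 : Module.End ℝ (X → ℝ)} {A1 : (X → ℝ) →ₗ[ℝ] (Y → ℝ)} {A2 : (Y → ℝ) →ₗ[ℝ] (X → ℝ)} {A4 : Module.End ℝ (Y → ℝ)}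
    (hRlen : ∀ a a', Rel a a' → g.len a = g.len a') (hRd₁ : ∀ a a' b, Rel a a' → g.dist a b = g.dist a' b)
    (hRd₂ : ∀ a b b', Rel b b' → g.dist a b = g.dist a b')
    {m : ℕ} (hmult : ∀ y' : g.Site, (Finset.univ.filter (fun y'' => Rel y'' y')).card ≤ m)
    {KL δ : ℝ} (hKL : 0 ≤ KL) (hlen : ∀ y : g.Site, 0 ≤ g.len y)
    (hb0 : BlockBd (g := toB6 g R H) blk blk A0 (fun (y y' : g.Site) => KL * B9.pref6 (g.len y) 0 * Real.exp (-(δ * g.dist y y'))))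
    (hb1 : BlockBd (g := toB6 g R H) blk blkY A1 (fun (y y' : g.Site) => KL * B9.pref6 (g.len y) 1 * Real.exp (-(δ * g.dist y y'))))
    (hb2 : BlockBd (g := toB6 g R H) blkY blk A2 (fun (y y' : g.Site) => KL * B9.pref6 (g.len y) 2 * Real.exp (-(δ * g.dist y y'))))
    (hb3 : BlockBd (g := toB6 g R H) blk blk A3 (fun (y y' : g.Site) => KL * B9.pref6 (g.len y) 3 * Real.exp (-(δ * g.dist y y'))))
    (hb4 : BlockBd (g := toB6 g R H) blkY blkY A4 (fun (y y' : g.Site) => KL * B9.pref6 (g.len y) 4 * Real.exp (-(δ * g.dist y y'))))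
    (hb5 : BlockBd (g := toB6 g R H) blk blk A5 (fun (y y' : g.Site) => KL * B9.pref6 (g.len y) 5 * Real.exp (-(δ * g.dist y y'))))
    (hl0 : L2ReadsRel (R := R) (H := H) K 0 U Rel blk blk ev A0) (hl1 : L2ReadsRel (R := R) (H := H) K 1 U Rel blkY blk ev A1)
    (hl2 : L2ReadsRel (R := R) (H := H) K 2 U Rel blk blkY evY A2) (hl3 : L2ReadsRel (R := R) (H := H) K 3 U Rel blk blk ev A3)
    (hl4 : L2ReadsRel (R := R) (H := H) K 4 U Rel blkY blkY evY A4) (hl5 : L2ReadsRel (R := R) (H := H) K 5 U Rel blk blk ev A5) :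
    L2Block K (m * m * KL) δ U := by
  intro n
  fin_cases n
  · exact l2line_of_blockBd_rel hl0 hRlen hRd₁ hRd₂ hmult hKL hlen hb0
  · exact l2line_of_blockBd_rel hl1 hRlen hRd₁ hRd₂ hmult hKL hlen hb1
  · exact l2line_of_blockBd_rel hl2 hRlen hRd₁ hRd₂ hmult hKL hlen hb2
  · exact l2line_of_blockBd_rel hl3 hRlen hRd₁ hRd₂ hmult hKL hlen hb3
  · exact l2line_of_blockBd_rel hl4 hRlen hRd₁ hRd₂ hmult hKL hlen hb4
  · exact l2line_of_blockBd_rel hl5 hRlen hRd₁ hRd₂ hmult hKL hlen hb5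

omit [Fintype X] [Fintype PX] in
/-- **THE HÖLDER BLOCK (3.43)–(3.45) OF A CO-READ KERNEL FAMILY from the four operator-level majorants**, relative reading: the two probe
majorants B_h(β)(Lʲη)^{1−β}e^{−δd} of Φ^Y_β∘A₁ and Φ^X_β∘A₂ ((3.43), `H1ReadsRel`), the input-class majorants K₄₄(ε)e^{−δd} of A₄ and
K₄₅(ε,β)(Lʲη)^{−β}e^{−δd} of Φ^Y_β∘A₄ ((3.44)–(3.45), `InputReadsRel`) ⇒ `B9.Ineq343_345 K (m·B_h) K₄₄ K₄₅ δ U` (n06-k's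
`line343_of_hasMajorantHom_rel` and `lines3445_of_hasMaj_rel`). [cite: Balaban1985BackgroundPropagators, (3.43)–(3.45) p.398; Balaban1984PropagatorsII, (2.51)–(2.52) p.232] -/
theorem ineq343_345_of_majorants_rel {K : B9.KernelFamily g B} {U : B.Cfg} (𝔭 : HolderProbes g B X Y PX PY)
    (bH : ℝ → BlockNorm (toB6 g R H) (Y → ℝ)) {Rel : g.Site → g.Site → Prop} [DecidableRel Rel]
    {blk : X → g.Site} {blkY : Y → g.Site} {ev : g.Loc → X → ℝ} {evY : g.Loc → Y → ℝ}
    {A1 : (X → ℝ) →ₗ[ℝ] (Y → ℝ)} {A2 : (Y → ℝ) →ₗ[ℝ] (X → ℝ)} {A4 : Module.End ℝ (Y → ℝ)}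
    (hRlen : ∀ a a', Rel a a' → g.len a = g.len a') (hRd₁ : ∀ a a' b, Rel a a' → g.dist a b = g.dist a' b)
    (hRd₂ : ∀ a b b', Rel b b' → g.dist a b = g.dist a b')
    {m : ℕ} (hmult : ∀ y' : g.Site, (Finset.univ.filter (fun y'' => Rel y'' y')).card ≤ m)
    {Bh K44 : ℝ → ℝ} {K45 : ℝ → ℝ → ℝ} {δ : ℝ} (hBh : ∀ β, 0 ≤ β → β < 1 → 0 ≤ Bh β)
    (hK44 : ∀ ε, 0 < ε → ε ≤ 1 → 0 ≤ K44 ε) (hK45 : ∀ ε β, 0 < ε → ε ≤ 1 → 0 ≤ β → β < 1 → 0 ≤ K45 ε β)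
    (hlen : ∀ y : g.Site, 0 < g.len y)
    (hL : ∀ β, 0 ≤ β → β < 1 → HasMajorantHom (g := toB6 g R H) blk 𝔭.blkPY (𝔭.ΦY U β ∘ₗ A1)
      (fun (a b : g.Site) => Bh β * g.len a ^ (1 - β) * Real.exp (-(δ * g.dist a b))))
    (hRt : ∀ β, 0 ≤ β → β < 1 → HasMajorantHom (g := toB6 g R H) blkY 𝔭.blkPX (𝔭.ΦX U β ∘ₗ A2)
      (fun (a b : g.Site) => Bh β * g.len a ^ (1 - β) * Real.exp (-(δ * g.dist a b))))
    (h44 : ∀ ε, 0 < ε → ε ≤ 1 → HasMaj (bH ε) (BlockNorm.ofBlocks (toB6 g R H) blkY) A4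
      (fun (a b : g.Site) => K44 ε * Real.exp (-(δ * g.dist a b))))
    (h45 : ∀ ε β, 0 < ε → ε ≤ 1 → 0 ≤ β → β < 1 →
      HasMaj (bH (β + ε)) (BlockNorm.ofBlocks (toB6 g R H) 𝔭.blkPY) (𝔭.ΦY U β ∘ₗ A4)
        (fun (a b : g.Site) => K45 ε β * g.len a ^ (-β) * Real.exp (-(δ * g.dist a b))))
    (hH1 : H1ReadsRel K U 𝔭 Rel blk blkY ev evY A1 A2) (hIR : InputReadsRel K U 𝔭 bH Rel blkY evY A4) :
    B9.Ineq343_345 K (fun β => m * Bh β) K44 K45 δ U := by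
  have h343 := line343_of_hasMajorantHom_rel (R := R) (H := H) hH1 hRlen hRd₁ hRd₂ hmult hBh (fun y => (hlen y).le) hL hRt
  have h3445 := lines3445_of_hasMaj_rel (R := R) (H := H) hIR hRlen hRd₁ hK44 hK45 hlen h44 h45
  exact ⟨h343, h3445.1, h3445.2⟩

end Reading

/-! ## §2 One member, one U, one propagator: both blocks from the schemas -/

section OneMember

variable {g : B9.Geometry} {B : B9.Backgrounds} {X Y Z W PX PY : Type}
variable [Fintype X] [Fintype Y] [Fintype PX] [Fintype PY] [Fintype g.Site] [DecidableEq g.Site]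
variable {R₀ : ℝ} {H₀ : Prop}

omit [Fintype PX] [Fintype PY] [DecidableEq g.Site] in
/-- Rates of the L² schema: Theorem 3.3's block-L² bounds at (B₂, δ₁) hold at every smaller rate δ₁′ ≦ δ₁ (B₂ ≧ 0, d ≧ 0).
[cite: Balaban1985BackgroundPropagators, (3.46) p.398 (bookkeeping)] -/
theorem thm33G0L2_mono {𝔬 : Ops g B X Y Z W} {Lap : B.Cfg → Module.End ℝ (X → ℝ)} {B₂ δ₁ δ₁' : ℝ} {U : B.Cfg}
    (hG : GeoOK g) (hB₂ : 0 ≤ B₂) (hδ : δ₁' ≤ δ₁) (h : Thm33G0L2 𝔬 Lap R₀ H₀ B₂ δ₁ U) :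
    Thm33G0L2 𝔬 Lap R₀ H₀ B₂ δ₁' U := by
  have hexp : ∀ y y' : g.Site, Real.exp (-(δ₁ * g.dist y y')) ≤ Real.exp (-(δ₁' * g.dist y y')) := fun y y' =>
    Real.exp_le_exp.mpr (neg_le_neg (mul_le_mul_of_nonneg_right hδ (hG.dnn y y')))
  have hl : ∀ y : g.Site, 0 ≤ g.len y := hG.lenle
  have hli : ∀ y : g.Site, 0 ≤ (g.len y)⁻¹ := fun y => inv_nonneg.mpr (hl y)
  exact
    { l0 := h.l0.mono fun y y' => mul_le_mul_of_nonneg_left (hexp y y') (mul_nonneg (mul_nonneg hB₂ (hl y)) (hl y'))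
      l1 := h.l1.mono fun y y' => mul_le_mul_of_nonneg_left (hexp y y') (mul_nonneg hB₂ (hl y'))
      l2 := h.l2.mono fun y y' => mul_le_mul_of_nonneg_left (hexp y y') (mul_nonneg hB₂ (hl y))
      l3 := h.l3.mono fun y y' => mul_le_mul_of_nonneg_left (hexp y y') (mul_nonneg hB₂ (mul_nonneg (hli y) (hl y')))
      l4 := h.l4.mono fun y y' => mul_le_mul_of_nonneg_left (hexp y y') hB₂
      l5 := h.l5.mono fun y y' => mul_le_mul_of_nonneg_left (hexp y y') (mul_nonneg hB₂ (mul_nonneg (hl y) (hli y'))) }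

/-- **The L² constant of one propagator**: the three classes' constants summed so that it dominates each line — B₀(1 − θc)⁻¹Λ₁ (line 0),
(C₁ + B₀(1 − θc)⁻¹)Λ_h (lines 1, 2), K₄(1 + Λ₁ + Λ₋) (lines 4, 3, 5), K₄ = B₂ + B₂θ₂B₂(1 − B₂θ₂c²)⁻¹c².
[cite: Balaban1985BackgroundPropagators, (3.46) p.398 + Thm 3.12 p.423] -/
def constL2 (B₀ θ θD B₂ θ₂ c Λ₁ Λh Λm : ℝ) : ℝ :=
  B₀ * (1 - θ * c)⁻¹ * Λ₁ + (B₀ + θD * (B₀ * (1 - θ * c)⁻¹) * c + B₀ * (1 - θ * c)⁻¹) * Λh +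
    (B₂ + B₂ * (θ₂ * (B₂ * (1 - B₂ * θ₂ * c * c)⁻¹) * c) * c) * (1 + Λ₁ + Λm)

/-- ★ **THEOREM 3.12 — THE L² BLOCK (3.46) OF A KERNEL FAMILY CO-READ BY ONE SECT.-D PROPAGATOR, AT ONE MEMBER AND ONE CONFIGURATION,
FROM THE SCHEMAS.**  Data at U: A with (Δ_a − T)A = I and G₀Δ_a = I (A = G for T = Δ′_π, G₁ for T = Δ′_π + Δ⁽²⁾_π); Theorem 3.3 for G₀ in the
sup classes (`he0 he1 he2`) and the block-L² classes (`hL2`); the perturbation step on 𝔠⁽¹⁾, 𝔠⁽²⁾ (`hK1 hK2`), its derivative (`hKD`) and its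
block-L² bound (`hT2`); A symmetric and (∇_UA)ᵀ = A∇\*_U (letters); [4] Lemma 2.1 as the row sum (2.61) at σ and three scale transfers (2.60)
(γ = 1, ½, −1); the relative co-readings of `K.l2 0…5` by A, ∇_UA, A∇\*_U, Δ_UA, ∇_UA∇\*_U, AΔ_U; the class data (m, saturation).  Provisos:
ρ ≦ δ₀, ρ + σ ≦ δ_K, θc < 1, B₂θ₂c² < 1, 0 ≦ ρ_f, ρ_f + σ ≦ (1 − α)ρ, ρ_f + 2σ + αρ ≦ ρ.  Conclusion: `L2Block K (m·m·constL2 …) ρ_f U` — lines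
0, 1, 2 by the Schur test from the PROVED sup majorants (`…L2.l2bd_entry0∕12_of_sup`), lines 3, 4, 5 by r1-g6's Neumann bookkeeping
(`l2bd_entry3∕4∕5_of_step`), then `l2Block_of_blockBds_rel`.  Nothing of print asserted. [cite: Balaban1985BackgroundPropagators, Thm 3.12 p.423 + Thm 3.3 p.399 + (3.46) p.398 + (3.130)–(3.131) pp.421–422 + (3.138) p.423; Balaban1984PropagatorsII, Lemma 2.1 (2.60)–(2.61) p.234] -/
theorem l2Block_of_step (hG : GeoOK g) {K : B9.KernelFamily g B} {U : B.Cfg} (𝔬 : Ops g B X Y Z W)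
    (Lap : B.Cfg → Module.End ℝ (X → ℝ)) (Rel : g.Site → g.Site → Prop) [DecidableRel Rel]
    (ev : g.Loc → X → ℝ) (evY : g.Loc → Y → ℝ) {A T : Module.End ℝ (X → ℝ)} {m : ℕ}
    {θ θD θ₂ B₀ B₂ δ₀ δK ρ ρf σ α c Λ₁ Λh Λm : ℝ}
    (hrow : RowSum (toB6 g R₀ H₀) σ c)
    (hθ : 0 ≤ θ) (hθD : 0 ≤ θD) (hθ₂ : 0 ≤ θ₂) (hB₀ : 0 ≤ B₀) (hB₂ : 0 ≤ B₂) (hσ : 0 ≤ σ) (hα : 0 ≤ α)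
    (hρ : 0 ≤ ρ) (hρS : ρ ≤ δ₀) (hρδ : ρ + σ ≤ δK) (hq : θ * c < 1) (hq₂ : B₂ * θ₂ * c * c < 1)
    (hρf : 0 ≤ ρf) (hρf1 : ρf + σ ≤ (1 - α) * ρ) (hρf2 : ρf + 2 * σ + α * ρ ≤ ρ)
    (hΛ₁ : 0 ≤ Λ₁) (hΛh : 0 ≤ Λh) (hΛm : 0 ≤ Λm)
    (hST1 : ScaleTransfer g ρ α Λ₁ (fun y => g.len y ^ (1 : ℝ)))
    (hSTh : ScaleTransfer g ρ α Λh (fun y => g.len y ^ (1 / 2 : ℝ)))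
    (hSTm : ScaleTransfer g ρ α Λm (fun y => g.len y ^ (-1 : ℝ)))
    (hI0 : 𝔬.G0 U * 𝔬.S0 U = 1) (hIA : (𝔬.S0 U - T) * A = 1)
    (he0 : HasMajorant (g := toB6 g R₀ H₀) 𝔬.blk (𝔬.G0 U) (fun a b => B₀ * g.len a ^ 2 * Real.exp (-(δ₀ * g.dist a b))))
    (he1 : HasMajorantHom (g := toB6 g R₀ H₀) 𝔬.blk 𝔬.blkY (𝔬.D U ∘ₗ 𝔬.G0 U)
      (fun (a b : g.Site) => B₀ * g.len a * Real.exp (-(δ₀ * g.dist a b))))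
    (he2 : HasMajorantHom (g := toB6 g R₀ H₀) 𝔬.blkY 𝔬.blk (𝔬.G0 U ∘ₗ 𝔬.Dstar U)
      (fun (a b : g.Site) => B₀ * g.len a * Real.exp (-(δ₀ * g.dist a b))))
    (hL2 : Thm33G0L2 𝔬 Lap R₀ H₀ B₂ δ₀ U)
    (hK1 : HasMaj (cNorm R₀ H₀ 𝔬.blk hG.lenle 1) (cNorm R₀ H₀ 𝔬.blk hG.lenle 1) (𝔬.G0 U ∘ₗ T)
      (fun a b => θ * Real.exp (-(δK * g.dist a b))))
    (hK2 : HasMaj (cNorm R₀ H₀ 𝔬.blk hG.lenle 2) (cNorm R₀ H₀ 𝔬.blk hG.lenle 2) (𝔬.G0 U ∘ₗ T)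
      (fun a b => θ * Real.exp (-(δK * g.dist a b))))
    (hKD : HasMaj (cNorm R₀ H₀ 𝔬.blk hG.lenle 2) (cNorm R₀ H₀ 𝔬.blkY hG.lenle 1) (𝔬.D U ∘ₗ 𝔬.G0 U ∘ₗ T)
      (fun a b => θD * Real.exp (-(δK * g.dist a b))))
    (hT2 : BlockBd (g := toB6 g R₀ H₀) 𝔬.blk 𝔬.blk T
      (fun (y y' : g.Site) => θ₂ * (g.len y)⁻¹ * (g.len y')⁻¹ * Real.exp (-(δK * g.dist y y'))))
    (hsym : IsTransposePair A A) (htr : IsTransposePair (𝔬.D U ∘ₗ A) (A ∘ₗ 𝔬.Dstar U))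
    (hRlen : ∀ a a', Rel a a' → g.len a = g.len a') (hRd₁ : ∀ a a' b, Rel a a' → g.dist a b = g.dist a' b)
    (hRd₂ : ∀ a b b', Rel b b' → g.dist a b = g.dist a b')
    (hmult : ∀ y' : g.Site, (Finset.univ.filter (fun y'' => Rel y'' y')).card ≤ m)
    (hl0 : L2ReadsRel (R := R₀) (H := H₀) K 0 U Rel 𝔬.blk 𝔬.blk ev A)
    (hl1 : L2ReadsRel (R := R₀) (H := H₀) K 1 U Rel 𝔬.blkY 𝔬.blk ev (𝔬.D U ∘ₗ A))
    (hl2 : L2ReadsRel (R := R₀) (H := H₀) K 2 U Rel 𝔬.blk 𝔬.blkY evY (A ∘ₗ 𝔬.Dstar U))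
    (hl3 : L2ReadsRel (R := R₀) (H := H₀) K 3 U Rel 𝔬.blk 𝔬.blk ev (Lap U ∘ₗ A))
    (hl4 : L2ReadsRel (R := R₀) (H := H₀) K 4 U Rel 𝔬.blkY 𝔬.blkY evY (𝔬.D U ∘ₗ (A ∘ₗ 𝔬.Dstar U)))
    (hl5 : L2ReadsRel (R := R₀) (H := H₀) K 5 U Rel 𝔬.blk 𝔬.blk ev (A ∘ₗ Lap U)) :
    L2Block K (m * m * constL2 B₀ θ θD B₂ θ₂ c Λ₁ Λh Λm) ρf U := by
  -- a row-sum constant is non-negative as soon as there is a site; without sites every block statement is vacuous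
  have hc : 0 ≤ c ∨ IsEmpty g.Site := by
    by_cases hne : Nonempty g.Site
    · exact Or.inl (hrow.nonneg hne.some)
    · exact Or.inr (not_nonempty_iff.mp hne)
  rcases hc with hc | hemp
  swap
  · exact fun n lam h y => (hemp.false y).elim
  -- constants
  have hq1 : 0 ≤ (1 - θ * c)⁻¹ := inv_nonneg.mpr (by linarith)
  have hB₀'0 : 0 ≤ B₀ * (1 - θ * c)⁻¹ := mul_nonneg hB₀ hq1
  have hC₁0 : 0 ≤ B₀ + θD * (B₀ * (1 - θ * c)⁻¹) * c := add_nonneg hB₀ (mul_nonneg (mul_nonneg hθD hB₀'0) hc)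
  have hq₂1 : 0 ≤ (1 - B₂ * θ₂ * c * c)⁻¹ := inv_nonneg.mpr (by linarith)
  have hK₄0 : 0 ≤ B₂ + B₂ * (θ₂ * (B₂ * (1 - B₂ * θ₂ * c * c)⁻¹) * c) * c :=
    add_nonneg hB₂ (mul_nonneg (mul_nonneg hB₂ (mul_nonneg (mul_nonneg hθ₂ (mul_nonneg hB₂ hq₂1)) hc)) hc)
  have ha0 : 0 ≤ B₀ * (1 - θ * c)⁻¹ * Λ₁ := mul_nonneg hB₀'0 hΛ₁
  have hb0 : 0 ≤ (B₀ + θD * (B₀ * (1 - θ * c)⁻¹) * c + B₀ * (1 - θ * c)⁻¹) * Λh := mul_nonneg (add_nonneg hC₁0 hB₀'0) hΛh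
  have hs1 : 1 ≤ 1 + Λ₁ + Λm := by linarith
  have hc0 : B₂ + B₂ * (θ₂ * (B₂ * (1 - B₂ * θ₂ * c * c)⁻¹) * c) * c ≤
      (B₂ + B₂ * (θ₂ * (B₂ * (1 - B₂ * θ₂ * c * c)⁻¹) * c) * c) * (1 + Λ₁ + Λm) :=
    le_mul_of_one_le_right hK₄0 hs1
  have hc3 : (B₂ + B₂ * (θ₂ * (B₂ * (1 - B₂ * θ₂ * c * c)⁻¹) * c) * c) * Λ₁ ≤
      (B₂ + B₂ * (θ₂ * (B₂ * (1 - B₂ * θ₂ * c * c)⁻¹) * c) * c) * (1 + Λ₁ + Λm) :=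
    mul_le_mul_of_nonneg_left (by linarith) hK₄0
  have hc5 : (B₂ + B₂ * (θ₂ * (B₂ * (1 - B₂ * θ₂ * c * c)⁻¹) * c) * c) * Λm ≤
      (B₂ + B₂ * (θ₂ * (B₂ * (1 - B₂ * θ₂ * c * c)⁻¹) * c) * c) * (1 + Λ₁ + Λm) :=
    mul_le_mul_of_nonneg_left (by linarith) hK₄0
  have hcc : 0 ≤ (B₂ + B₂ * (θ₂ * (B₂ * (1 - B₂ * θ₂ * c * c)⁻¹) * c) * c) * (1 + Λ₁ + Λm) :=
    mul_nonneg hK₄0 (by linarith)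
  have hKL0 : 0 ≤ constL2 B₀ θ θD B₂ θ₂ c Λ₁ Λh Λm := by unfold constL2; linarith
  have hKLa : B₀ * (1 - θ * c)⁻¹ * Λ₁ ≤ constL2 B₀ θ θD B₂ θ₂ c Λ₁ Λh Λm := by unfold constL2; linarith
  have hKLb : (B₀ + θD * (B₀ * (1 - θ * c)⁻¹) * c + B₀ * (1 - θ * c)⁻¹) * Λh ≤ constL2 B₀ θ θD B₂ θ₂ c Λ₁ Λh Λm := by
    unfold constL2; linarith
  have hKL4 : B₂ + B₂ * (θ₂ * (B₂ * (1 - B₂ * θ₂ * c * c)⁻¹) * c) * c ≤ constL2 B₀ θ θD B₂ θ₂ c Λ₁ Λh Λm := by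
    unfold constL2; linarith
  have hKL3 : (B₂ + B₂ * (θ₂ * (B₂ * (1 - B₂ * θ₂ * c * c)⁻¹) * c) * c) * Λ₁ ≤ constL2 B₀ θ θD B₂ θ₂ c Λ₁ Λh Λm := by
    unfold constL2; linarith
  have hKL5 : (B₂ + B₂ * (θ₂ * (B₂ * (1 - B₂ * θ₂ * c * c)⁻¹) * c) * c) * Λm ≤ constL2 B₀ θ θD B₂ θ₂ c Λ₁ Λh Λm := by
    unfold constL2; linarith
  -- rates
  have hαρ : 0 ≤ α * ρ := mul_nonneg hα hρ
  have hρf_le : ρf ≤ (1 - α) * ρ := by linarith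
  have h1αρ : (1 - α) * ρ ≤ ρ := by linarith
  have hρL0 : 0 ≤ ρf + α * ρ := add_nonneg hρf hαρ
  have hρL2 : ρf + α * ρ + 2 * σ ≤ ρ := by linarith
  have hexp : ∀ {r r' : ℝ}, r' ≤ r → ∀ y y' : g.Site, Real.exp (-(r * g.dist y y')) ≤ Real.exp (-(r' * g.dist y y')) :=
    fun h y y' => Real.exp_le_exp.mpr (neg_le_neg (mul_le_mul_of_nonneg_right h (hG.dnn y y')))
  -- (3.130)
  have hfix : A = 𝔬.G0 U + 𝔬.G0 U ∘ₗ T ∘ₗ A := fix_of_inverses hI0 hIA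
  -- the sup majorants of A, ∇_UA, A∇* (proved upstream)
  have hm0 := entry0_of_step hG hrow hθ hB₀ hρ hρS hρδ hK2 he0 hfix hq
  have hm1 := entry1_of_stepD hG hrow hθ hθD hB₀ hρ hρS hρδ hK2 hKD he0 he1 hfix hq
  have hm2 := entry2_of_step hG hrow hθ hB₀ hρ hρS hρδ hK1 he2 hfix hq
  -- lines 0, 1, 2 by Schur
  have hb0 := l2bd_entry0_of_sup (R₀ := R₀) (H₀ := H₀) hG hB₀'0 hST1 hm0 hsym
  have hm1' : HasMajorantHom (g := toB6 g R₀ H₀) 𝔬.blk 𝔬.blkY (𝔬.D U ∘ₗ A)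
      (fun (a b : g.Site) => (B₀ + θD * (B₀ * (1 - θ * c)⁻¹) * c + B₀ * (1 - θ * c)⁻¹) * g.len a *
        Real.exp (-(ρ * g.dist a b))) :=
    hasMajorantHom_mono (g := toB6 g R₀ H₀) 𝔬.blk 𝔬.blkY hm1 fun a b =>
      mul_le_mul_of_nonneg_right (mul_le_mul_of_nonneg_right (by linarith) (hG.lenle a)) (Real.exp_nonneg _)
  have hm2' : HasMajorantHom (g := toB6 g R₀ H₀) 𝔬.blkY 𝔬.blk (A ∘ₗ 𝔬.Dstar U)
      (fun (a b : g.Site) => (B₀ + θD * (B₀ * (1 - θ * c)⁻¹) * c + B₀ * (1 - θ * c)⁻¹) * g.len a *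
        Real.exp (-(ρ * g.dist a b))) :=
    hasMajorantHom_mono (g := toB6 g R₀ H₀) 𝔬.blkY 𝔬.blk hm2 fun a b =>
      mul_le_mul_of_nonneg_right (mul_le_mul_of_nonneg_right (by linarith) (hG.lenle a)) (Real.exp_nonneg _)
  obtain ⟨hb1, hb2⟩ := l2bd_entry12_of_sup (R₀ := R₀) (H₀ := H₀) hG (add_nonneg hC₁0 hB₀'0) hSTh hm1' hm2' htr
  -- lines 3, 4, 5 by r1's Neumann bookkeeping at the rate ρf + αρ (schemas brought to the common rate ρ)
  have hL2ρ : Thm33G0L2 𝔬 Lap R₀ H₀ B₂ ρ U := thm33G0L2_mono hG hB₂ hρS hL2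
  have hT2ρ : BlockBd (g := toB6 g R₀ H₀) 𝔬.blk 𝔬.blk T
      (fun (y y' : g.Site) => θ₂ * (g.len y)⁻¹ * (g.len y')⁻¹ * Real.exp (-(ρ * g.dist y y'))) :=
    hT2.mono fun y y' => mul_le_mul_of_nonneg_left (hexp (by linarith) y y')
      (mul_nonneg (mul_nonneg hθ₂ (inv_nonneg.mpr (hG.lenle y))) (inv_nonneg.mpr (hG.lenle y')))
  have hb4 := l2bd_entry4_of_step (Lap := Lap) hG hrow hB₂ hθ₂ hρL0 hσ hρL2 hL2ρ hT2ρ hfix hq₂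
  have hb3 := l2bd_entry3_of_step hG hrow hB₂ hθ₂ hρL0 hσ hρL2 hST1 hL2ρ hT2ρ hfix hq₂
  have hb5 := l2bd_entry5_of_step hG hrow hB₂ hθ₂ hρL0 hσ hρL2 hSTm hL2ρ hT2ρ hfix hq₂
  have hρL' : ρf + α * ρ - α * ρ = ρf := by ring
  rw [hρL'] at hb3 hb5
  -- all six at (constL2, ρf) in the pref6 shapes
  have hP : ∀ t : ℝ, B9.pref6 t 0 = t ^ 2 ∧ B9.pref6 t 1 = t ∧ B9.pref6 t 2 = t ∧ B9.pref6 t 3 = 1 ∧ B9.pref6 t 4 = 1 ∧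
      B9.pref6 t 5 = 1 := fun t => by simp [B9.pref6]
  have hw : ∀ {Kx r : ℝ} (P : g.Site → ℝ), (∀ y, 0 ≤ P y) → Kx ≤ constL2 B₀ θ θD B₂ θ₂ c Λ₁ Λh Λm → ρf ≤ r →
      ∀ y y' : g.Site, Kx * P y * Real.exp (-(r * g.dist y y')) ≤
        constL2 B₀ θ θD B₂ θ₂ c Λ₁ Λh Λm * P y * Real.exp (-(ρf * g.dist y y')) :=
    fun P hP hK hr y y' => mul_le_mul (mul_le_mul_of_nonneg_right hK (hP y)) (hexp hr y y') (Real.exp_nonneg _)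
      (mul_nonneg hKL0 (hP y))
  have hB0 : BlockBd (g := toB6 g R₀ H₀) 𝔬.blk 𝔬.blk A
      (fun (y y' : g.Site) => constL2 B₀ θ θD B₂ θ₂ c Λ₁ Λh Λm * B9.pref6 (g.len y) 0 * Real.exp (-(ρf * g.dist y y'))) := by
    refine hb0.mono fun y y' => ?_
    rw [(hP (g.len y)).1]
    have h := hw (Kx := B₀ * (1 - θ * c)⁻¹ * Λ₁) (r := (1 - α) * ρ) (fun y => g.len y ^ 2) (fun y => sq_nonneg _) hKLa
      hρf_le y y'
    simpa only [mul_assoc] using h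
  have hB1 : BlockBd (g := toB6 g R₀ H₀) 𝔬.blk 𝔬.blkY (𝔬.D U ∘ₗ A)
      (fun (y y' : g.Site) => constL2 B₀ θ θD B₂ θ₂ c Λ₁ Λh Λm * B9.pref6 (g.len y) 1 * Real.exp (-(ρf * g.dist y y'))) := by
    refine hb1.mono fun y y' => ?_
    rw [(hP (g.len y)).2.1]
    have h := hw (Kx := (B₀ + θD * (B₀ * (1 - θ * c)⁻¹) * c + B₀ * (1 - θ * c)⁻¹) * Λh) (r := (1 - α) * ρ)
      (fun y => g.len y) hG.lenle hKLb hρf_le y y'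
    simpa only [mul_assoc] using h
  have hB2 : BlockBd (g := toB6 g R₀ H₀) 𝔬.blkY 𝔬.blk (A ∘ₗ 𝔬.Dstar U)
      (fun (y y' : g.Site) => constL2 B₀ θ θD B₂ θ₂ c Λ₁ Λh Λm * B9.pref6 (g.len y) 2 * Real.exp (-(ρf * g.dist y y'))) := by
    refine hb2.mono fun y y' => ?_
    rw [(hP (g.len y)).2.2.1]
    have h := hw (Kx := (B₀ + θD * (B₀ * (1 - θ * c)⁻¹) * c + B₀ * (1 - θ * c)⁻¹) * Λh) (r := (1 - α) * ρ)
      (fun y => g.len y) hG.lenle hKLb hρf_le y y'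
    simpa only [mul_assoc] using h
  have hB3 : BlockBd (g := toB6 g R₀ H₀) 𝔬.blk 𝔬.blk (Lap U ∘ₗ A)
      (fun (y y' : g.Site) => constL2 B₀ θ θD B₂ θ₂ c Λ₁ Λh Λm * B9.pref6 (g.len y) 3 * Real.exp (-(ρf * g.dist y y'))) := by
    refine hb3.mono fun y y' => ?_
    rw [(hP (g.len y)).2.2.2.1, mul_one]
    exact mul_le_mul_of_nonneg_right hKL3 (Real.exp_nonneg _)
  have hB4 : BlockBd (g := toB6 g R₀ H₀) 𝔬.blkY 𝔬.blkY (𝔬.D U ∘ₗ (A ∘ₗ 𝔬.Dstar U))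
      (fun (y y' : g.Site) => constL2 B₀ θ θD B₂ θ₂ c Λ₁ Λh Λm * B9.pref6 (g.len y) 4 * Real.exp (-(ρf * g.dist y y'))) := by
    refine hb4.mono fun y y' => ?_
    rw [(hP (g.len y)).2.2.2.2.1, mul_one]
    exact mul_le_mul hKL4 (hexp (by linarith) y y') (Real.exp_nonneg _) hKL0
  have hB5 : BlockBd (g := toB6 g R₀ H₀) 𝔬.blk 𝔬.blk (A ∘ₗ Lap U)
      (fun (y y' : g.Site) => constL2 B₀ θ θD B₂ θ₂ c Λ₁ Λh Λm * B9.pref6 (g.len y) 5 * Real.exp (-(ρf * g.dist y y'))) := by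
    refine hb5.mono fun y y' => ?_
    rw [(hP (g.len y)).2.2.2.2.2, mul_one]
    exact mul_le_mul_of_nonneg_right hKL5 (Real.exp_nonneg _)
  exact l2Block_of_blockBds_rel (R := R₀) (H := H₀) hRlen hRd₁ hRd₂ hmult hKL0 hG.lenle hB0 hB1 hB2 hB3 hB4 hB5
    hl0 hl1 hl2 hl3 hl4 hl5

/-- ★ **THEOREM 3.12 — THE HÖLDER BLOCK (3.43)–(3.45) OF A KERNEL FAMILY CO-READ BY ONE SECT.-D PROPAGATOR, AT ONE MEMBER AND ONE
CONFIGURATION, FROM THE SCHEMAS.**  Data at U: A with (Δ_a − T)A = I and G₀Δ_a = I; Theorem 3.3 for G₀ — (3.42)₁,₂,₃ (`he0 he1 he2`) and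
the Hölder members through the probes and input norms (`hH0 : Thm33G0H …`); the perturbation step on 𝔠⁽¹⁾, 𝔠⁽²⁾ (`hK1 hK2`), its
derivative (`hKD`) and its Hölder-class members (`hpY hpX htD`, the fields of `StepH` for this T); [4] Lemma 2.1 as the row sum at σ and the
scale transfer at γ = 1; the relative co-readings `H1ReadsRel` (of `K.h1` by ∇_UA, A∇\*_U) and `InputReadsRel` (of `K.e4`, `K.h2` by ∇_UA∇\*_U);
the class data.  Provisos: ρ ≦ δ₀, ρ + σ ≦ δ_K, θc < 1, 0 ≦ ρ_f, ρ_f + σ ≦ (1 − α)ρ.  Conclusion: `B9.Ineq343_345 K (m·(B_h + θ_H B₀(1 − θc)⁻¹c))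
(B_i + C₁Λ₁θ_Hc) (B_i2 + (B_h + θ_HB₀(1 − θc)⁻¹c)Λ₁θ_Hc) ρ_f U`, C₁ = B₀ + θ_D B₀(1 − θc)⁻¹c — `…Holder.probe43L∕43R∕input44∕45_of_step`, then
`ineq343_345_of_majorants_rel`.  Nothing of print asserted. [cite: Balaban1985BackgroundPropagators, Thm 3.12 p.423 + Thm 3.3 p.399 + (3.43)–(3.45) p.398 + (3.130)–(3.131) pp.421–422 + (3.138) p.423; Balaban1984PropagatorsII, Lemma 2.1 (2.60)–(2.61) p.234] -/
theorem holder_of_step (hG : GeoOK g) {K : B9.KernelFamily g B} {U : B.Cfg} (𝔬 : Ops g B X Y Z W)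
    (𝔭 : HolderProbes g B X Y PX PY) (bH : ℝ → BlockNorm (toB6 g R₀ H₀) (Y → ℝ))
    (Rel : g.Site → g.Site → Prop) [DecidableRel Rel] (ev : g.Loc → X → ℝ) (evY : g.Loc → Y → ℝ)
    {A T : Module.End ℝ (X → ℝ)} {m : ℕ}
    {θ θD θH B₀ δ₀ δK ρ ρf σ α c Λ₁ : ℝ} {Bh Bi : ℝ → ℝ} {Bi2 : ℝ → ℝ → ℝ}
    (hrow : RowSum (toB6 g R₀ H₀) σ c)
    (hθ : 0 ≤ θ) (hθD : 0 ≤ θD) (hθH : 0 ≤ θH) (hB₀ : 0 ≤ B₀) (hσ : 0 ≤ σ) (hα : 0 ≤ α)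
    (hρ : 0 ≤ ρ) (hρS : ρ ≤ δ₀) (hρδ : ρ + σ ≤ δK) (hq : θ * c < 1)
    (hρf : 0 ≤ ρf) (hρf1 : ρf + σ ≤ (1 - α) * ρ) (hΛ₁ : 0 ≤ Λ₁)
    (hBh : ∀ β, 0 ≤ β → β < 1 → 0 ≤ Bh β) (hBi : ∀ ε, 0 < ε → ε ≤ 1 → 0 ≤ Bi ε)
    (hBi2 : ∀ ε β, 0 < ε → ε ≤ 1 → 0 ≤ β → β < 1 → 0 ≤ Bi2 ε β)
    (hST1 : ScaleTransfer g ρ α Λ₁ (fun y => g.len y ^ (1 : ℝ)))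
    (hI0 : 𝔬.G0 U * 𝔬.S0 U = 1) (hIA : (𝔬.S0 U - T) * A = 1)
    (he0 : HasMajorant (g := toB6 g R₀ H₀) 𝔬.blk (𝔬.G0 U) (fun a b => B₀ * g.len a ^ 2 * Real.exp (-(δ₀ * g.dist a b))))
    (he1 : HasMajorantHom (g := toB6 g R₀ H₀) 𝔬.blk 𝔬.blkY (𝔬.D U ∘ₗ 𝔬.G0 U)
      (fun (a b : g.Site) => B₀ * g.len a * Real.exp (-(δ₀ * g.dist a b))))
    (he2 : HasMajorantHom (g := toB6 g R₀ H₀) 𝔬.blkY 𝔬.blk (𝔬.G0 U ∘ₗ 𝔬.Dstar U)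
      (fun (a b : g.Site) => B₀ * g.len a * Real.exp (-(δ₀ * g.dist a b))))
    (hH0 : Thm33G0H 𝔬 𝔭 R₀ H₀ bH Bh Bi Bi2 δ₀ U)
    (hK1 : HasMaj (cNorm R₀ H₀ 𝔬.blk hG.lenle 1) (cNorm R₀ H₀ 𝔬.blk hG.lenle 1) (𝔬.G0 U ∘ₗ T)
      (fun a b => θ * Real.exp (-(δK * g.dist a b))))
    (hK2 : HasMaj (cNorm R₀ H₀ 𝔬.blk hG.lenle 2) (cNorm R₀ H₀ 𝔬.blk hG.lenle 2) (𝔬.G0 U ∘ₗ T)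
      (fun a b => θ * Real.exp (-(δK * g.dist a b))))
    (hKD : HasMaj (cNorm R₀ H₀ 𝔬.blk hG.lenle 2) (cNorm R₀ H₀ 𝔬.blkY hG.lenle 1) (𝔬.D U ∘ₗ 𝔬.G0 U ∘ₗ T)
      (fun a b => θD * Real.exp (-(δK * g.dist a b))))
    (hpY : ∀ β : ℝ, 0 ≤ β → β < 1 → HasMaj (cNormR R₀ H₀ 𝔬.blk hG.lenle (-2)) (cNormR R₀ H₀ 𝔭.blkPY hG.lenle (β - 1))
      ((𝔭.ΦY U β ∘ₗ 𝔬.D U ∘ₗ 𝔬.G0 U) ∘ₗ T) (fun a b => θH * Real.exp (-(δK * g.dist a b))))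
    (hpX : ∀ β : ℝ, 0 ≤ β → β < 1 → HasMaj (cNormR R₀ H₀ 𝔬.blk hG.lenle (-1)) (cNormR R₀ H₀ 𝔭.blkPX hG.lenle (β - 1))
      ((𝔭.ΦX U β ∘ₗ 𝔬.G0 U) ∘ₗ T) (fun a b => θH * Real.exp (-(δK * g.dist a b))))
    (htD : ∀ ε : ℝ, 0 < ε → HasMaj (bH ε) (cNormR R₀ H₀ 𝔬.blk hG.lenle 1) (T ∘ₗ (𝔬.G0 U ∘ₗ 𝔬.Dstar U))
      (fun a b => θH * Real.exp (-(δK * g.dist a b))))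
    (hRlen : ∀ a a', Rel a a' → g.len a = g.len a') (hRd₁ : ∀ a a' b, Rel a a' → g.dist a b = g.dist a' b)
    (hRd₂ : ∀ a b b', Rel b b' → g.dist a b = g.dist a b')
    (hmult : ∀ y' : g.Site, (Finset.univ.filter (fun y'' => Rel y'' y')).card ≤ m)
    (hH1 : H1ReadsRel K U 𝔭 Rel 𝔬.blk 𝔬.blkY ev evY (𝔬.D U ∘ₗ A) (A ∘ₗ 𝔬.Dstar U))
    (hIR : InputReadsRel K U 𝔭 bH Rel 𝔬.blkY evY (𝔬.D U ∘ₗ (A ∘ₗ 𝔬.Dstar U))) :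
    B9.Ineq343_345 K (fun β => m * (Bh β + θH * (B₀ * (1 - θ * c)⁻¹) * c))
      (fun ε => Bi ε + (B₀ + θD * (B₀ * (1 - θ * c)⁻¹) * c) * Λ₁ * θH * c)
      (fun ε β => Bi2 ε β + (Bh β + θH * (B₀ * (1 - θ * c)⁻¹) * c) * Λ₁ * θH * c) ρf U := by
  have hc : 0 ≤ c ∨ IsEmpty g.Site := by
    by_cases hne : Nonempty g.Site
    · exact Or.inl (hrow.nonneg hne.some)
    · exact Or.inr (not_nonempty_iff.mp hne)
  rcases hc with hc | hemp
  swap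
  · exact ⟨fun β lam ζ y => (hemp.false y).elim, fun ε lam y => (hemp.false y).elim, fun ε β lam ζ y => (hemp.false y).elim⟩
  have hq1 : 0 ≤ (1 - θ * c)⁻¹ := inv_nonneg.mpr (by linarith)
  have hB₀'0 : 0 ≤ B₀ * (1 - θ * c)⁻¹ := mul_nonneg hB₀ hq1
  have hC₁0 : 0 ≤ B₀ + θD * (B₀ * (1 - θ * c)⁻¹) * c := add_nonneg hB₀ (mul_nonneg (mul_nonneg hθD hB₀'0) hc)
  have hαρ : 0 ≤ α * ρ := mul_nonneg hα hρ
  have hρfρ : ρf ≤ ρ := by linarith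
  have hρfK : ρf ≤ δK := by linarith
  have hρf0 : ρf ≤ δ₀ := hρfρ.trans hρS
  have hexp : ∀ {r r' : ℝ}, r' ≤ r → ∀ y y' : g.Site, Real.exp (-(r * g.dist y y')) ≤ Real.exp (-(r' * g.dist y y')) :=
    fun h y y' => Real.exp_le_exp.mpr (neg_le_neg (mul_le_mul_of_nonneg_right h (hG.dnn y y')))
  have hfix : A = 𝔬.G0 U + 𝔬.G0 U ∘ₗ T ∘ₗ A := fix_of_inverses hI0 hIA
  have hfixR : A = 𝔬.G0 U + A ∘ₗ T ∘ₗ 𝔬.G0 U := fix_right_of_inverses hI0 hIA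
  have hm1 := entry1_of_stepD hG hrow hθ hθD hB₀ hρ hρS hρδ hK2 hKD he0 he1 hfix hq
  have hBhA : ∀ β, 0 ≤ β → β < 1 → 0 ≤ Bh β + θH * (B₀ * (1 - θ * c)⁻¹) * c := fun β h0 h1 =>
    add_nonneg (hBh β h0 h1) (mul_nonneg (mul_nonneg hθH hB₀'0) hc)
  -- (3.43) at the rate ρ, weakened to ρf
  have h43L : ∀ β, 0 ≤ β → β < 1 → HasMajorantHom (g := toB6 g R₀ H₀) 𝔬.blk 𝔭.blkPY (𝔭.ΦY U β ∘ₗ (𝔬.D U ∘ₗ A))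
      (fun (a b : g.Site) => (Bh β + θH * (B₀ * (1 - θ * c)⁻¹) * c) * g.len a ^ (1 - β) * Real.exp (-(ρf * g.dist a b))) := by
    intro β h0 h1
    have h := probe43L_of_step hG 𝔭 hrow hθ hθH hB₀ (hBh β h0 h1) hρ hρS hρδ hK2 he0 (hH0.h43L β h0 h1) (hpY β h0 h1) hfix hq
    exact hasMajorantHom_mono (g := toB6 g R₀ H₀) 𝔬.blk 𝔭.blkPY h fun a b =>
      mul_le_mul_of_nonneg_left (hexp hρfρ a b) (mul_nonneg (hBhA β h0 h1) (Real.rpow_nonneg (hG.lenle a) _))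
  have h43R : ∀ β, 0 ≤ β → β < 1 → HasMajorantHom (g := toB6 g R₀ H₀) 𝔬.blkY 𝔭.blkPX (𝔭.ΦX U β ∘ₗ (A ∘ₗ 𝔬.Dstar U))
      (fun (a b : g.Site) => (Bh β + θH * (B₀ * (1 - θ * c)⁻¹) * c) * g.len a ^ (1 - β) * Real.exp (-(ρf * g.dist a b))) := by
    intro β h0 h1
    have h := probe43R_of_step hG 𝔭 hrow hθ hθH hB₀ (hBh β h0 h1) hρ hρS hρδ hK1 he2 (hH0.h43R β h0 h1) (hpX β h0 h1) hfix hq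
    exact hasMajorantHom_mono (g := toB6 g R₀ H₀) 𝔬.blkY 𝔭.blkPX h fun a b =>
      mul_le_mul_of_nonneg_left (hexp hρfρ a b) (mul_nonneg (hBhA β h0 h1) (Real.rpow_nonneg (hG.lenle a) _))
  -- (3.44), (3.45) at the rate ρf through the right form
  have h44 : ∀ ε, 0 < ε → ε ≤ 1 → HasMaj (bH ε) (BlockNorm.ofBlocks (toB6 g R₀ H₀) 𝔬.blkY) (𝔬.D U ∘ₗ (A ∘ₗ 𝔬.Dstar U))
      (fun (a b : g.Site) => (Bi ε + (B₀ + θD * (B₀ * (1 - θ * c)⁻¹) * c) * Λ₁ * θH * c) *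
        Real.exp (-(ρf * g.dist a b))) := fun ε h0 h1 =>
    input44_of_step hG hrow hθH (hBi ε h0 h1) hC₁0 hΛ₁ hρf hρf1 hρfK hρf0 hST1 hm1 (hH0.h44 ε h0 h1) (htD ε h0) hfixR
  have h45 : ∀ ε β, 0 < ε → ε ≤ 1 → 0 ≤ β → β < 1 →
      HasMaj (bH (β + ε)) (BlockNorm.ofBlocks (toB6 g R₀ H₀) 𝔭.blkPY) (𝔭.ΦY U β ∘ₗ (𝔬.D U ∘ₗ (A ∘ₗ 𝔬.Dstar U)))
        (fun (a b : g.Site) => (Bi2 ε β + (Bh β + θH * (B₀ * (1 - θ * c)⁻¹) * c) * Λ₁ * θH * c) * g.len a ^ (-β) *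
          Real.exp (-(ρf * g.dist a b))) := by
    intro ε β hε0 hε1 h0 h1
    have h43' : HasMajorantHom (g := toB6 g R₀ H₀) 𝔬.blk 𝔭.blkPY (((𝔭.ΦY U β ∘ₗ 𝔬.D U) ∘ₗ 𝔬.G0 U))
        (fun (a b : g.Site) => Bh β * g.len a ^ (1 - β) * Real.exp (-(δ₀ * g.dist a b))) := hH0.h43L β h0 h1
    have hA := probe43L_cNormR hG hrow hθ hθH hB₀ (hBh β h0 h1) hρ hρS hρδ hK2 he0 h43' (hpY β h0 h1) hfix hq
    have h := input45_of_step hG hrow hθH (hBi2 ε β hε0 hε1 h0 h1) (hBhA β h0 h1) hΛ₁ hρf hρf1 hρfK hρf0 hST1 hA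
      (hH0.h45 ε β hε0 hε1 h0 h1) (htD (β + ε) (by linarith)) hfixR
    exact h.congr fun μ => rfl
  exact ineq343_345_of_majorants_rel (R := R₀) (H := H₀) 𝔭 bH hRlen hRd₁ hRd₂ hmult hBhA
    (fun ε h0 h1 => add_nonneg (hBi ε h0 h1) (mul_nonneg (mul_nonneg (mul_nonneg hC₁0 hΛ₁) hθH) hc))
    (fun ε β hε0 hε1 h0 h1 => add_nonneg (hBi2 ε β hε0 hε1 h0 h1)
      (mul_nonneg (mul_nonneg (mul_nonneg (hBhA β h0 h1) hΛ₁) hθH) hc))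
    hG.lenpos h43L h43R h44 h45 hH1 hIR

end OneMember

end

end Literature.MathematicalPhysics.QuantumFieldTheory.Balaban1983to89.B9Thm312WholeBlocksRel
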